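import Summits.BirchSwinnertonDyer.BirchSwinnertonDyer.Theses.KolyvaginRankRigidityAtTwo

/-!
# Route `KolyvaginRankRigidityAtTwo`, LINE 14: the glue of the V1′∞ split holds (by name)

Item `StrongNonzeroSystemOfSeedTransport` (support/glue of the LINE-14 split of crux
`KolyvaginStrongNonzeroSystemAtTwo` = V1′∞, stmt-BirchSwinnertonDyer-27983, into the SEED half
U1 `KolyvaginBoundedDefectAtTwo` (Kolyvagin's conjecture at 2 in exponent currency: bounded defect at a fixed
depth, every deep level) and the TRANSPORT half U2 `FullClassDeepeningAtTwo` (a nearly full class moves to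
primes of any index at the same depth, staying non-zero)). Pen seat `bsd-idea-1` g7. THEOREM-ONLY file (no
definition, no named fact, no `sorry`): given the frame take `c` from U2 and `(r, m)` from U1, put
`M := c·(m+r+1) + m + 1 > m`, take U1's class at level `M` and transport it with U2.
BSD is not proved by this; V1′∞ is not proved by this (children ⟹ parent only); U1 and U2 stay open.
-/

set_option autoImplicit false
set_option linter.dupNamespace false
set_option linter.unusedVariables false

namespace Summit.BirchSwinnertonDyer.BirchSwinnertonDyer.Theorems.KolyvaginRigidity

open scoped Classical
open Summit.BirchSwinnertonDyer.BirchSwinnertonDyer.Theses.KolyvaginRankRigidityAtTwo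

/-- **Glue of LINE 14** (by name): `KolyvaginBoundedDefectAtTwo → FullClassDeepeningAtTwo →
KolyvaginStrongNonzeroSystemAtTwo` — choose the level `M := c·(m+r+1)+m+1`. [folklore] -/
theorem strongNonzeroSystemOfSeedTransport_proof : StrongNonzeroSystemOfSeedTransport := by
  intro h₁ h₂ W _ _ hCM hred hsur K _ _ hK _ hHN hodd hne3 htor hH2 Dt β ι hβ
  obtain ⟨c, hc⟩ := h₂ W hCM hred hsur K hK hHN hodd hne3 htor hH2 Dt β ι hβ
  obtain ⟨r, m, hrm⟩ := h₁ W hCM hred hsur K hK hHN hodd hne3 htor hH2 Dt β ι hβ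
  refine ⟨r, fun θ k ↦ ?_⟩
  obtain ⟨n, d, hn, hr, hlev, hne⟩ := hrm (c * (m + r + 1) + m + 1) (by omega)
  exact hc θ k r m (c * (m + r + 1) + m + 1) n d hn hr hlev (by omega) hne

end Summit.BirchSwinnertonDyer.BirchSwinnertonDyer.Theorems.KolyvaginRigidity
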